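import Literature.MathematicalPhysics.QuantumManyBody.JelliumBoseGasCondensateDilation
import Literature.MathematicalPhysics.QuantumManyBody.BoseGasThermodynamicLimitProofs
import Summits.AtomisticToContinuum.BoseEinsteinCondensation.Theorems.BECHardSphereReductionHardSphereScaling
import Summits.AtomisticToContinuum.BoseEinsteinCondensation.Theorems.BECCutLineWeakDisorderGroundStateRigidityStubEnergyTruncAux
import HarnessLib

/-!
# Route `BECHardSphereReduction`, crux `HardSphereBEC` (stmt-AtomisticToContinuum-11885),
# line `registered` (`Lines/birth.lean`): the registered stub `stub_leftLowerSemicontinuous_of`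

Supports (does not close) stmt-AtomisticToContinuum-11885; stub `stub_leftLowerSemicontinuous_of`
(S4) of the birth line (lead c6).  Write `HS_r = ⊤ · 1_{(-∞, r]}`
(`Set.indicator (Set.Iic r) (fun _ => ⊤)`) for the hard-sphere pair potential of core diameter
`r`, `E₀(v, N, L) = groundStateEnergy v N L` (Dirichlet box `Λ_L`, `C¹` symmetric normalised
trial states), `cn(L) = condensateNumber HS₁ N L` and, for a slack `δ ∈ [0, ∞]`,
`I_L(δ) = inf {λ_max(γ_Ψ) | Ψ on Λ_L, 𝓔_{HS₁}[Ψ] ≤ E₀(HS₁, N, L) + δ}`, so that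
`cn(L) = sup_{δ > 0} I_L(δ)` by definition.

**Statement (S4).**  Assume S3 (right-continuity of the hard-sphere ground-state energy in the
core diameter: for all `N, L`, every `δ > 0` and `E₀(HS₁, N, L) < ∞` there is `θ > 0` with
`E₀(HS_{1+θ}, N, L) ≤ E₀(HS₁, N, L) + δ`).  Then for every `N`, every box `x > 0` and every
level `C`: if there are boxes `x' < x` arbitrarily close to `x` with `cn(x') ≤ C`, then
`cn(x) ≤ C` — the sublevel sets of `L ↦ cn(L)` are closed under approach from the LEFT.

**Proof.**
1. *Left upper semicontinuity of the energy in the box* (`LeftLsc.groundStateEnergy_left_upper`):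
   for `x > 0`, `η > 0` and `E := E₀(HS₁, N, x) < ∞` there is `ε > 0` with
   `E₀(HS₁, N, x') ≤ E + η` for all `x' > x - ε`.  Indeed S3 gives `θ > 0` with
   `E₀(HS_{1+θ}, N, x) ≤ E + η/2 =: M < ∞`; pick `τ > 0` with `τ M < η/2`
   (`ENNReal.exists_nnreal_pos_mul_lt`).  For `x' = s x` with
   `s > 1 - min (θ/(1+θ)) (τ/(2(1+τ)))` one has `s (1+θ) ≥ 1` and `s⁻² ≤ 1 + τ`, and the exact
   dilation covariance of the tree (`JelliumBoseGas.groundStateEnergy_dilate` together with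
   `scalePotential s HS_{1+θ} = HS_{s(1+θ)} ≥ HS₁`) gives
   `E₀(HS₁, N, sx) ≤ E₀(HS_{s(1+θ)}, N, sx) = s⁻² E₀(HS_{1+θ}, N, x) ≤ (1+τ) M ≤ M + η/2 = E + η`.
2. *Shadowing* (`LeftLsc.iInf_maxOccupation_le_of_le`): if `x' ≤ x` and
   `E₀(x') + δ' ≤ E₀(x) + δ` then `I_x(δ) ≤ I_{x'}(δ')` — a `δ'`-near-minimiser of the box `x'`
   IS (`TrialState.enlarge`: same wave function, same energy, same `λ_max`) a `δ`-near-minimiser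
   of the box `x`.
3. Given `δ > 0`: if `E₀(x) = ∞` every `x'` of the hypothesis qualifies in 2; otherwise 1 (with
   `η = δ/2`) and the hypothesis give `x' ∈ (x - ε, x)` with `cn(x') ≤ C` and
   `E₀(x') + δ/2 ≤ E₀(x) + δ`.  Hence `I_x(δ) ≤ I_{x'}(δ/2) ≤ cn(x') ≤ C` for every `δ > 0`,
   i.e. `cn(x) ≤ C`.

Elementary (order theory of `iSup`/`iInf` in `ℝ≥0∞` plus the tree's dilation API and the
monotonicity of `E₀` in the potential, `GroundStateRigidity.EnergyTrunc.groundStateEnergy_mono`);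
the helper lemmas live in the sub-namespace `LeftLsc`. [folklore]
-/

noncomputable section

open scoped ENNReal NNReal

namespace Summit.AtomisticToContinuum.BoseEinsteinCondensation.Cruxes.HardSphereBEC.Birth

open Literature.MathematicalPhysics.QuantumManyBody
open Literature.MathematicalPhysics.QuantumManyBody.BoseGas
open Summit.AtomisticToContinuum.BoseEinsteinCondensation.Theorems

namespace LeftLsc

variable {N : ℕ}

/-! ### Hard spheres: monotonicity in the diameter and dilation -/

/-- The hard-sphere potential is monotone in the core diameter: `HS_a ≤ HS_b` for `a ≤ b`.
[folklore] -/
theorem hardSphere_mono {a b : ℝ} (hab : a ≤ b) (r : ℝ) :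
    Set.indicator (Set.Iic a) (fun _ : ℝ => (⊤ : ℝ≥0∞)) r ≤
      Set.indicator (Set.Iic b) (fun _ : ℝ => (⊤ : ℝ≥0∞)) r :=
  Set.indicator_le_indicator_of_subset (Set.Iic_subset_Iic.2 hab) (fun _ => le_top) r

/-- Dilating the hard sphere of diameter `d` by `s > 0` gives the hard sphere of diameter `s d`:
`scalePotential s HS_d = HS_{sd}` (`s⁻² · ⊤ = ⊤`, `s⁻² · 0 = 0`, `s⁻¹ r ≤ d ↔ r ≤ s d`).
[folklore] -/
theorem scalePotential_hardSphere {s : ℝ} (hs : 0 < s) (d : ℝ) :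
    scalePotential s (Set.indicator (Set.Iic d) (fun _ : ℝ => (⊤ : ℝ≥0∞))) =
      Set.indicator (Set.Iic (s * d)) (fun _ : ℝ => (⊤ : ℝ≥0∞)) := by
  funext r
  rw [scalePotential_apply]
  have hpos : ENNReal.ofReal (s ^ 2)⁻¹ ≠ 0 :=
    (ENNReal.ofReal_pos.2 (inv_pos.2 (pow_pos hs 2))).ne'
  by_cases hr : r ≤ s * d
  · have hr' : s⁻¹ * r ≤ d := by rwa [inv_mul_le_iff₀ hs]
    rw [Set.indicator_of_mem (show s⁻¹ * r ∈ Set.Iic d from hr'),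
      Set.indicator_of_mem (show r ∈ Set.Iic (s * d) from hr), ENNReal.mul_top hpos]
  · have hr' : ¬ s⁻¹ * r ≤ d := by rwa [inv_mul_le_iff₀ hs]
    rw [Set.indicator_of_notMem (show s⁻¹ * r ∉ Set.Iic d from hr'),
      Set.indicator_of_notMem (show r ∉ Set.Iic (s * d) from hr), mul_zero]

/-! ### Near-minimiser infima -/

/-- **Shadowing of near-minimiser infima by a smaller box.**  If `x' ≤ x` and
`E₀(v, N, x') + δ' ≤ E₀(v, N, x) + δ`, then every `δ'`-near-minimiser of the box `x'` is (as the
same wave function, `TrialState.enlarge`) a `δ`-near-minimiser of the box `x` with the same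
`λ_max`, so `I_x(δ) ≤ I_{x'}(δ')`. [folklore] -/
theorem iInf_maxOccupation_le_of_le (v : ℝ → ℝ≥0∞) {x' x : ℝ} (hle : x' ≤ x) {δ δ' : ℝ≥0∞}
    (hE : groundStateEnergy v N x' + δ' ≤ groundStateEnergy v N x + δ) :
    ⨅ (Ψ : TrialState N x) (_ : energy v Ψ ≤ groundStateEnergy v N x + δ), maxOccupation N Ψ.ψ ≤
      ⨅ (Ψ : TrialState N x') (_ : energy v Ψ ≤ groundStateEnergy v N x' + δ'),
        maxOccupation N Ψ.ψ :=
  le_iInf₂ fun Ψ hΨ =>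
    iInf₂_le (f := fun (Φ : TrialState N x) (_ : energy v Φ ≤ groundStateEnergy v N x + δ) =>
      maxOccupation N Φ.ψ) (Ψ.enlarge hle)
      ((TrialState.energy_enlarge hle v Ψ).trans_le (hΨ.trans hE))

/-- Each `δ`-level near-minimiser infimum is below the condensate number (`δ > 0`). [folklore] -/
theorem iInf_maxOccupation_le_condensateNumber (v : ℝ → ℝ≥0∞) {L : ℝ} {δ : ℝ≥0∞}
    (hδ : 0 < δ) :
    ⨅ (Ψ : TrialState N L) (_ : energy v Ψ ≤ groundStateEnergy v N L + δ), maxOccupation N Ψ.ψ ≤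
      condensateNumber v N L :=
  le_condensateNumber v hδ fun Ψ h => iInf_maxOccupation_le v Ψ h

/-! ### Two real inequalities -/

/-- If `s > 1 - θ/(1+θ) = 1/(1+θ)` (`θ > 0`) then `s (1 + θ) ≥ 1`. [folklore] -/
theorem one_le_mul_one_add {θ s : ℝ} (hθ : 0 < θ) (hs : 1 - θ / (1 + θ) < s) :
    1 ≤ s * (1 + θ) := by
  have h1 : (0 : ℝ) < 1 + θ := by positivity
  have h2 : 1 - θ / (1 + θ) = 1 / (1 + θ) := by
    rw [eq_div_iff h1.ne', sub_mul, one_mul, div_mul_cancel₀ _ h1.ne']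
    ring
  rw [h2, div_lt_iff₀ h1] at hs
  exact hs.le

/-- If `s > 1 - τ/(2(1+τ))` (`τ ≥ 0`) then `s⁻² ≤ 1 + τ`
(as `(1+τ)(1 - τ/(2(1+τ)))² = 1 + τ²/(4(1+τ)) ≥ 1`). [folklore] -/
theorem inv_sq_le_one_add {τ s : ℝ} (hτ : 0 ≤ τ) (hs : 1 - τ / (2 * (1 + τ)) < s) :
    (s ^ 2)⁻¹ ≤ 1 + τ := by
  have h1 : (0 : ℝ) < 1 + τ := by positivity
  have h1' : (1 + τ) ≠ 0 := h1.ne'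
  have hu1 : τ / (2 * (1 + τ)) < 1 := by
    rw [div_lt_one (by positivity)]
    linarith
  have hu0 : (0 : ℝ) ≤ 1 - τ / (2 * (1 + τ)) := by linarith
  have hs0 : 0 < s := by linarith
  have hsq : (1 - τ / (2 * (1 + τ))) ^ 2 ≤ s ^ 2 := pow_le_pow_left₀ hu0 hs.le 2
  have hkey : (1 + τ) * (1 - τ / (2 * (1 + τ))) ^ 2 = 1 + τ ^ 2 / (4 * (1 + τ)) := by
    field_simp
    ring
  rw [inv_le_iff_one_le_mul₀ (by positivity)]
  calc (1 : ℝ) ≤ 1 + τ ^ 2 / (4 * (1 + τ)) := le_add_of_nonneg_right (by positivity)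
    _ = (1 + τ) * (1 - τ / (2 * (1 + τ))) ^ 2 := hkey.symm
    _ ≤ (1 + τ) * s ^ 2 := by gcongr

/-! ### Left upper semicontinuity of the hard-sphere energy in the box (from S3) -/

/-- **The hard-sphere ground-state energy is left upper semicontinuous in the box, given S3.**
If the hard-sphere energy is right-continuous in the core diameter (S3), then for `x > 0`,
`η > 0` and `E₀(HS₁, N, x) < ∞` there is `ε > 0` with `E₀(HS₁, N, x') ≤ E₀(HS₁, N, x) + η` for
all `x' > x - ε` (dilate the box `x` with cores `1 + θ` down by `s = x'/x`: the cores stay `≥ 1`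
and the energy grows by the factor `s⁻² ≤ 1 + τ`). [folklore] -/
theorem groundStateEnergy_left_upper
    (hS3 : ∀ (N : ℕ) (L : ℝ) (δ : ℝ≥0∞), 0 < δ →
      groundStateEnergy (Set.indicator (Set.Iic 1) (fun _ : ℝ => (⊤ : ℝ≥0∞))) N L ≠ ⊤ →
      ∃ θ : ℝ, 0 < θ ∧
        groundStateEnergy (Set.indicator (Set.Iic (1 + θ)) (fun _ : ℝ => (⊤ : ℝ≥0∞))) N L ≤
          groundStateEnergy (Set.indicator (Set.Iic 1) (fun _ : ℝ => (⊤ : ℝ≥0∞))) N L + δ)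
    {x : ℝ} (hx : 0 < x) {η : ℝ≥0∞} (hη : 0 < η)
    (hE : groundStateEnergy (Set.indicator (Set.Iic 1) (fun _ : ℝ => (⊤ : ℝ≥0∞))) N x ≠ ⊤) :
    ∃ ε : ℝ, 0 < ε ∧ ∀ x' : ℝ, x - ε < x' →
      groundStateEnergy (Set.indicator (Set.Iic 1) (fun _ : ℝ => (⊤ : ℝ≥0∞))) N x' ≤
        groundStateEnergy (Set.indicator (Set.Iic 1) (fun _ : ℝ => (⊤ : ℝ≥0∞))) N x + η := by
  by_cases hηt : η = ⊤
  · exact ⟨1, one_pos, fun x' _ => by rw [hηt, add_top]; exact le_top⟩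
  have hη2 : 0 < η / 2 := ENNReal.half_pos hη.ne'
  have hη2t : η / 2 ≠ ⊤ := ne_top_of_le_ne_top hηt ENNReal.half_le_self
  obtain ⟨θ, hθ, hθE⟩ := hS3 N x (η / 2) hη2 hE
  have hMt : groundStateEnergy (Set.indicator (Set.Iic 1) (fun _ : ℝ => (⊤ : ℝ≥0∞))) N x +
      η / 2 ≠ ⊤ := ENNReal.add_ne_top.2 ⟨hE, hη2t⟩
  obtain ⟨τ, hτ0, hτM⟩ := ENNReal.exists_nnreal_pos_mul_lt hMt hη2.ne'
  have hτ0' : (0 : ℝ) < τ := NNReal.coe_pos.2 hτ0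
  have hτ1 : (0 : ℝ) < 2 * (1 + τ) := by positivity
  -- the relative tolerance on the box
  obtain ⟨ε₁, hε₁0, hε₁θ, hε₁τ⟩ : ∃ ε₁ : ℝ, 0 < ε₁ ∧ ε₁ ≤ θ / (1 + θ) ∧
      ε₁ ≤ (τ : ℝ) / (2 * (1 + τ)) :=
    ⟨min (θ / (1 + θ)) ((τ : ℝ) / (2 * (1 + τ))),
      lt_min (div_pos hθ (by positivity)) (div_pos hτ0' hτ1), min_le_left _ _, min_le_right _ _⟩
  have hε₁1 : ε₁ < 1 := hε₁θ.trans_lt (by rw [div_lt_one (by positivity)]; linarith)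
  refine ⟨x * ε₁, mul_pos hx hε₁0, fun x' hx' => ?_⟩
  have hx'0 : 0 < x' := by
    have h0 : 0 < x - x * ε₁ := by
      rw [← mul_one_sub]
      exact mul_pos hx (sub_pos.2 hε₁1)
    exact h0.trans hx'
  -- the dilation ratio `s = x'/x`
  obtain ⟨s, hs, hsx, hs1⟩ : ∃ s : ℝ, 0 < s ∧ s * x = x' ∧ 1 - ε₁ < s := by
    refine ⟨x' / x, div_pos hx'0 hx, div_mul_cancel₀ x' hx.ne', ?_⟩
    rw [lt_div_iff₀ hx]
    linarith
  have ha : 1 ≤ s * (1 + θ) := one_le_mul_one_add hθ (by linarith)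
  have hb : (s ^ 2)⁻¹ ≤ 1 + (τ : ℝ) := inv_sq_le_one_add τ.coe_nonneg (by linarith)
  have hbE : ENNReal.ofReal (s ^ 2)⁻¹ ≤ 1 + (τ : ℝ≥0∞) := by
    refine (ENNReal.ofReal_le_ofReal hb).trans_eq ?_
    rw [ENNReal.ofReal_add zero_le_one τ.coe_nonneg, ENNReal.ofReal_one, ENNReal.ofReal_coe_nnreal]
  calc groundStateEnergy (Set.indicator (Set.Iic 1) (fun _ : ℝ => (⊤ : ℝ≥0∞))) N x'
      = groundStateEnergy (Set.indicator (Set.Iic 1) (fun _ : ℝ => (⊤ : ℝ≥0∞))) N (s * x) := by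
        rw [hsx]
    _ ≤ groundStateEnergy (Set.indicator (Set.Iic (s * (1 + θ))) (fun _ : ℝ => (⊤ : ℝ≥0∞)))
          N (s * x) :=
        GroundStateRigidity.EnergyTrunc.groundStateEnergy_mono (hardSphere_mono ha) N (s * x)
    _ = groundStateEnergy
          (scalePotential s (Set.indicator (Set.Iic (1 + θ)) (fun _ : ℝ => (⊤ : ℝ≥0∞))))
          N (s * x) := by
        rw [scalePotential_hardSphere hs (1 + θ)]
    _ = ENNReal.ofReal (s ^ 2)⁻¹ *
          groundStateEnergy (Set.indicator (Set.Iic (1 + θ)) (fun _ : ℝ => (⊤ : ℝ≥0∞))) N x :=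
        JelliumBoseGas.groundStateEnergy_dilate _ N x hs
    _ ≤ ENNReal.ofReal (s ^ 2)⁻¹ *
          (groundStateEnergy (Set.indicator (Set.Iic 1) (fun _ : ℝ => (⊤ : ℝ≥0∞))) N x +
            η / 2) := by
        gcongr
    _ ≤ (1 + (τ : ℝ≥0∞)) *
          (groundStateEnergy (Set.indicator (Set.Iic 1) (fun _ : ℝ => (⊤ : ℝ≥0∞))) N x +
            η / 2) := by
        gcongr
    _ = groundStateEnergy (Set.indicator (Set.Iic 1) (fun _ : ℝ => (⊤ : ℝ≥0∞))) N x + η / 2 +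
          (τ : ℝ≥0∞) *
            (groundStateEnergy (Set.indicator (Set.Iic 1) (fun _ : ℝ => (⊤ : ℝ≥0∞))) N x +
              η / 2) := by
        rw [add_mul, one_mul]
    _ ≤ groundStateEnergy (Set.indicator (Set.Iic 1) (fun _ : ℝ => (⊤ : ℝ≥0∞))) N x + η / 2 +
          η / 2 := by
        gcongr
    _ = groundStateEnergy (Set.indicator (Set.Iic 1) (fun _ : ℝ => (⊤ : ℝ≥0∞))) N x + η := by
        rw [add_assoc, ENNReal.add_halves]

end LeftLsc

/-- **S4 — LEFT LOWER-SEMICONTINUITY OF `L ↦ cn(HS₁, N, L)` FROM S3.**  Given S3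
(right-continuity of the hard-sphere ground-state energy in the core diameter), for every `N`,
`x > 0` and level `C`: if boxes `x' < x` arbitrarily close to `x` have `cn(HS₁, N, x') ≤ C` then
`cn(HS₁, N, x) ≤ C`.  (For each slack `δ > 0` choose such an `x'` with, moreover,
`E₀(HS₁, N, x') + δ/2 ≤ E₀(HS₁, N, x) + δ` — any `x'` if `E₀(HS₁, N, x) = ∞`, else by the left
upper semicontinuity of the energy in the box, `LeftLsc.groundStateEnergy_left_upper`, which is
where S3 and dilation covariance enter; then the `δ/2`-near-minimisers of the box `x'` are
`δ`-near-minimisers of the box `x` with the same `λ_max` (`TrialState.enlarge`), so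
`I_x(δ) ≤ I_{x'}(δ/2) ≤ cn(x') ≤ C`, and `cn(x) = sup_δ I_x(δ) ≤ C`.) [folklore] -/
theorem stub_leftLowerSemicontinuous_of :
    (∀ (N : ℕ) (L : ℝ) (δ : ENNReal), 0 < δ → Literature.MathematicalPhysics.QuantumManyBody.BoseGas.groundStateEnergy (Set.indicator (Set.Iic 1) (fun _ : ℝ => (⊤ : ENNReal))) N L ≠ ⊤ → ∃ θ : ℝ, 0 < θ ∧ Literature.MathematicalPhysics.QuantumManyBody.BoseGas.groundStateEnergy (Set.indicator (Set.Iic (1 + θ)) (fun _ : ℝ => (⊤ : ENNReal))) N L ≤ Literature.MathematicalPhysics.QuantumManyBody.BoseGas.groundStateEnergy (Set.indicator (Set.Iic 1) (fun _ : ℝ => (⊤ : ENNReal))) N L + δ) →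
    ∀ (N : ℕ) (x : ℝ) (C : ENNReal), 0 < x → (∀ ε : ℝ, 0 < ε → ∃ x' : ℝ, x - ε < x' ∧ x' < x ∧ Literature.MathematicalPhysics.QuantumManyBody.BoseGas.condensateNumber (Set.indicator (Set.Iic 1) (fun _ : ℝ => (⊤ : ENNReal))) N x' ≤ C) → Literature.MathematicalPhysics.QuantumManyBody.BoseGas.condensateNumber (Set.indicator (Set.Iic 1) (fun _ : ℝ => (⊤ : ENNReal))) N x ≤ C := by
  intro hS3 N x C hx h
  unfold condensateNumber
  refine iSup₂_le fun δ hδ => ?_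
  -- a box `x' < x` below the level `C` whose `δ/2`-near-minimisers are `δ`-near-minimisers of `x`
  obtain ⟨x', hx'x, hcn, hE⟩ : ∃ x' : ℝ, x' < x ∧
      condensateNumber (Set.indicator (Set.Iic 1) (fun _ : ℝ => (⊤ : ℝ≥0∞))) N x' ≤ C ∧
      groundStateEnergy (Set.indicator (Set.Iic 1) (fun _ : ℝ => (⊤ : ℝ≥0∞))) N x' + δ / 2 ≤
        groundStateEnergy (Set.indicator (Set.Iic 1) (fun _ : ℝ => (⊤ : ℝ≥0∞))) N x + δ := by
    by_cases hEt : groundStateEnergy (Set.indicator (Set.Iic 1) (fun _ : ℝ => (⊤ : ℝ≥0∞))) N x = ⊤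
    · obtain ⟨x', -, hx'x, hcn⟩ := h 1 one_pos
      exact ⟨x', hx'x, hcn, by rw [hEt, top_add]; exact le_top⟩
    · obtain ⟨ε, hε, hεE⟩ :=
        LeftLsc.groundStateEnergy_left_upper hS3 hx (ENNReal.half_pos hδ.ne') hEt
      obtain ⟨x', hx'1, hx'x, hcn⟩ := h ε hε
      refine ⟨x', hx'x, hcn, ?_⟩
      calc groundStateEnergy (Set.indicator (Set.Iic 1) (fun _ : ℝ => (⊤ : ℝ≥0∞))) N x' + δ / 2
          ≤ groundStateEnergy (Set.indicator (Set.Iic 1) (fun _ : ℝ => (⊤ : ℝ≥0∞))) N x +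
              δ / 2 + δ / 2 := by
            gcongr
            exact hεE x' hx'1
        _ = groundStateEnergy (Set.indicator (Set.Iic 1) (fun _ : ℝ => (⊤ : ℝ≥0∞))) N x + δ := by
            rw [add_assoc, ENNReal.add_halves]
  calc ⨅ (Ψ : TrialState N x)
        (_ : energy (Set.indicator (Set.Iic 1) (fun _ : ℝ => (⊤ : ℝ≥0∞))) Ψ ≤
          groundStateEnergy (Set.indicator (Set.Iic 1) (fun _ : ℝ => (⊤ : ℝ≥0∞))) N x + δ),
        maxOccupation N Ψ.ψ
      ≤ ⨅ (Ψ : TrialState N x')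
          (_ : energy (Set.indicator (Set.Iic 1) (fun _ : ℝ => (⊤ : ℝ≥0∞))) Ψ ≤
            groundStateEnergy (Set.indicator (Set.Iic 1) (fun _ : ℝ => (⊤ : ℝ≥0∞))) N x' +
              δ / 2),
          maxOccupation N Ψ.ψ :=
        LeftLsc.iInf_maxOccupation_le_of_le _ hx'x.le hE
    _ ≤ condensateNumber (Set.indicator (Set.Iic 1) (fun _ : ℝ => (⊤ : ℝ≥0∞))) N x' :=
        LeftLsc.iInf_maxOccupation_le_condensateNumber _ (ENNReal.half_pos hδ.ne')
    _ ≤ C := hcn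

end Summit.AtomisticToContinuum.BoseEinsteinCondensation.Cruxes.HardSphereBEC.Birth
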